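import Literature.MathematicalPhysics.QuantumFieldTheory.Balaban1983to89.Node00.TwoRunSiteBlockAnimals

/-!
# NODE 00 — THE FRESH-CAUSE DECOMPOSITION OF THE INSIDE EVENT ON THE (2.18) INDEX OF RECORD: along an admissible sequence the small-field entries `Λ_j` SHRINK ((2.1):
# `Λ₁ ⊇ Ω₂ ⊇ Λ₂ ⊇ …`), and each `Λ_j` is a union of the level-`j` cubes of record, so every large-field cause is INHERITED UPWARD at the coarser grain; consequently a coarse
# block lies in the large-field region `Z_j = Λ_jᶜ` IF AND ONLY IF some finer block inside it is a FRESH large-field block at some level `i ≤ j` (inside `Z_i`, inside `Λ_{i−1}`)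

Cell `pub-ymgap`, YM-PLAN Track A (HUMAN RULING D-0062; width push D-0149); seat `pub-ymgap-dag-n20-d` (R134 (a) N20 NE7b s3) gen 35 — companion of `Node00/TwoRunSiteBlockAnimals`
(gen 33: `iterBlock_subset_of_mem_image`, `blockSaturated_seq_Λ_compl`, `pow_dvd_dCubeSide_of_le`, the saturation hypothesis SHAPE `∀ x x', iterBlockOf ℓ x = iterBlockOf ℓ x' → x ∈ Z
→ x' ∈ Z`) and of lit-balaban r11's `B14.Eq218Concrete.Seq` (the (2.18) summation index: (2.1)-chains `Ω_j, Λ_j ∈ 𝐃_j`, `Λ_j ⊆ Ω_j`, `Ω_{j+1} ⊆ Λ_j`, with `Chain21.Λ_antitone`).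
[III] = [Balaban1988Convergent]; [LF-II] = [Balaban1989LargeFieldII].
WHY.  The N20 size-reading letter of record (`Summits/…/BalabanUVNodesSpineReadingOfRecord13CoPHKComponentSizeBlocksSeqIndex`, gen 34) asks a supplier, per environment `S` and
far block `b`, for the relative weight of «the level-`lv j` block of `b` lies INSIDE `Z_j(s) = (s.Λ j)ᶜ`».  On the index of record that event is NOT where print pays: [LF-II]
(1.79) p. 383 ∕ (1.85) p. 386 carry one small factor per NEW large-field region, while «inside `Z_j`» also holds for every block whose interior met the large-field region at
an EARLIER level — by (2.1) `Λ_j ⊆ Λ_i` (`i ≤ j`) and the level-`j` cube grain, one finer large-field block anywhere inside a coarse block puts the whole coarse block into `Z_j`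
(INHERITANCE, ★ `iterBlock_subset_Λ_compl_of_subset`).  This file proves the exact converse bookkeeping: ★★ `exists_fresh_of_iterBlock_subset_Λ_compl` — if the coarse block
lies in `Z_j`, then at the LEAST level `i ≤ j` at which its interior meets the large-field region, the level-`lv i` block of a meeting point is a FRESH large-field block (inside
`Z_i`, and inside `Λ_{i−1}` when `i ≥ 2`), and ★★ `iterBlock_subset_Λ_compl_iff_exists_fresh` (the INSIDE event is the finite union of the FRESH-block events below it).  With
§3's count (`card_filter_iterBlock_subset`: a level-`ℓ` block contains `(L^d)^{ℓ−ℓ′}` level-`ℓ′` blocks) the Summits-side companion turns the one-block conditional letter into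
FRESH-BLOCK conditional letters with the inheritance volume `Σ_{i ≤ j} (L^d)^{lv j − lv i}` displayed in the numerics.
WHAT IS HERE (finite torus ∕ index combinatorics; theorems only, 0 `def`).  §1 block nesting across levels (`iterBlock_subset_iterBlock_of_le`, `iterBlock_subset_iterBlock_of_mem`,
`exists_mem_iterBlock`); §2 on `Seq (DOfRecord F ν M g K) k`: `seq_Λ_compl_mono` (`Z_i ⊆ Z_j`), ★ `iterBlock_subset_Λ_compl_of_subset`
(inheritance), ★★ `exists_fresh_of_iterBlock_subset_Λ_compl`, ★★ `iterBlock_subset_Λ_compl_iff_exists_fresh`; §3 `biUnion_filter_iterBlock_subset_eq`, `card_filter_iterBlock_subset`.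
HONEST — WHAT THIS IS NOT.  NO weight, NO measure, NO estimate; nothing of Bałaban's asserted; which levels a sequence of record actually RECORDS after the R-operation's
partial resummations ([Balaban1989LargeFieldI] (0.3) `Z″`, the residual selector `ppSel`) is not touched — the statements hold for every admissible sequence as indexed; NE7 ∕
NE7b ∕ NE7c NOT PRINTED for `d = 4` and NOT proved; no node count moves (typed 28∕28 · discharged 8∕27); no `sorry`, no `axiom`, no `instance`, no `notation`; one finite four-torus
programme at fixed `ε` — NOT ℝ⁴, NOT OS, NOT a mass gap, NOT the Clay problem.
-/

noncomputable section

open scoped BigOperators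

namespace Literature.MathematicalPhysics.QuantumFieldTheory.Balaban1983to89.Node00

open T4Continuum B5Eq118OneStroke

/-! ## §1  Block nesting across levels -/

section Nesting

variable {P : Params} {ℓ ℓ' : ℕ}

/-- NESTING: the `ℓ′`-block of a finest site lies inside its `ℓ`-block, `ℓ′ ≤ ℓ` (the block maps are iterates of one map: sites with the same `ℓ′`-fold block point have
the same `ℓ`-fold block point). [cite: Balaban1984PropagatorsI, (1.16)–(1.18) p.20 (bookkeeping)] -/
theorem iterBlock_subset_iterBlock_of_le (h : ℓ' ≤ ℓ) (x : Site P 0) :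
    (↑(iterBlock ℓ' (iterBlockOf ℓ' x)) : Set (Site P 0)) ⊆ ↑(iterBlock ℓ (iterBlockOf ℓ x)) := by
  intro y hy
  rw [Finset.mem_coe, mem_iterBlock] at hy ⊢
  obtain ⟨n, rfl⟩ := Nat.exists_eq_add_of_le h
  clear h
  induction n with
  | zero => simpa using hy
  | succ n ih =>
    have hs : ℓ' + (n + 1) = (ℓ' + n) + 1 := by omega
    rw [hs, iterBlockOf_succ, iterBlockOf_succ, ih]

/-- NESTING, block form: an `ℓ′`-block meeting an `ℓ`-block (`ℓ′ ≤ ℓ`) lies inside it. [cite: Balaban1984PropagatorsI, (1.16) p.20 (bookkeeping)] -/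
theorem iterBlock_subset_iterBlock_of_mem (h : ℓ' ≤ ℓ) {c : Site P ℓ'} {B : Site P ℓ} {x : Site P 0} (hxc : x ∈ iterBlock ℓ' c) (hxB : x ∈ iterBlock ℓ B) :
    (↑(iterBlock ℓ' c) : Set (Site P 0)) ⊆ ↑(iterBlock ℓ B) := by
  rw [mem_iterBlock] at hxc hxB
  rw [← hxc, ← hxB]
  exact iterBlock_subset_iterBlock_of_le h x

/-- In the standing range a block has a finest site (it has `(L^d)^ℓ > 0` of them, `card_iterBlock`). [cite: Balaban1984PropagatorsI, (1.18) p.20 (bookkeeping)] -/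
theorem exists_mem_iterBlock (hℓ : ℓ ≤ P.m + P.K) (B : Site P ℓ) : ∃ x : Site P 0, x ∈ iterBlock ℓ B := by
  have h : (iterBlock ℓ B).Nonempty := by
    rw [← Finset.card_pos, card_iterBlock ℓ hℓ B]
    exact pow_pos (pow_pos P.L_pos _) _
  exact h

end Nesting

/-! ## §2  Inheritance and the fresh-cause decomposition on the index of record -/

section Fresh

variable (F : T4Family) (ν : Stage7Numerics) (M : ℕ) (g : ℕ → ℝ) (K k : ℕ) (s : B14.Eq218Concrete.Seq (DOfRecord F ν M g K) k)

/-- **THE LARGE-FIELD REGIONS OF AN ADMISSIBLE SEQUENCE GROW**: `Z_i = (Λ_i)ᶜ ⊆ (Λ_j)ᶜ = Z_j` for `1 ≤ i ≤ j ≤ k` ((2.1): `Λ_j ⊆ Λ_i`). [cite: Balaban1988Convergent, (2.1) p.254, (2.3) p.255 (bookkeeping)] -/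
theorem seq_Λ_compl_mono {i j : ℕ} (hi : 1 ≤ i) (hij : i ≤ j) (hjk : j ≤ k) : (s.Λ i)ᶜ ⊆ (s.Λ j)ᶜ :=
  Set.compl_subset_compl.2 (s.chain.Λ_antitone hi hij hjk)

/-- ★ **INHERITANCE**: if a level-`ℓ′` block inside the level-`ℓ` block `B` lies in `Z_i`, `1 ≤ i ≤ j ≤ k`, and `L^ℓ` divides the level-`j` cube side of record, then the
WHOLE block `B` lies in `Z_j` — `Z_i ⊆ Z_j` meets `B`, and `Z_j` is `ℓ`-block-saturated. [cite: Balaban1988Convergent, (2.1) p.254, (2.3) p.255 (bookkeeping)] -/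
theorem iterBlock_subset_Λ_compl_of_subset {i j ℓ ℓ' : ℕ} (hi : 1 ≤ i) (hij : i ≤ j) (hjk : j ≤ k) (hℓ' : ℓ' ≤ F.m + K) (hℓ : ℓ ≤ F.m + K)
    (hdvd : F.L ^ ℓ ∣ dCubeSide F.L M (RkOfRecord F.L ν.r (g j)) j) {c : Site (F.P K) ℓ'} {B : Site (F.P K) ℓ}
    (hcB : (↑(iterBlock ℓ' c) : Set (Site (F.P K) 0)) ⊆ ↑(iterBlock ℓ B)) (hc : (↑(iterBlock ℓ' c) : Set (Site (F.P K) 0)) ⊆ (s.Λ i)ᶜ) :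
    (↑(iterBlock ℓ B) : Set (Site (F.P K) 0)) ⊆ (s.Λ j)ᶜ := by
  obtain ⟨x, hx⟩ := exists_mem_iterBlock (P := F.P K) hℓ' c
  have hxZ : x ∈ (s.Λ j)ᶜ := seq_Λ_compl_mono F ν M g K k s hi hij hjk (hc (Finset.mem_coe.2 hx))
  have hxB : iterBlockOf ℓ x = B := (mem_iterBlock ℓ B x).1 (hcB (Finset.mem_coe.2 hx))
  exact iterBlock_subset_of_mem_image (blockSaturated_seq_Λ_compl F ν M g K k s hℓ hdvd) ⟨x, hxZ, hxB⟩

/-- The same with the divisibility discharged by `ℓ ≤ j` (`pow_dvd_dCubeSide_of_le`). [cite: Balaban1988Convergent, (2.1) p.254, (2.3) p.255 (bookkeeping)] -/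
theorem iterBlock_subset_Λ_compl_of_subset_of_le {i j ℓ ℓ' : ℕ} (hi : 1 ≤ i) (hij : i ≤ j) (hjk : j ≤ k) (hℓ' : ℓ' ≤ F.m + K) (hℓ : ℓ ≤ F.m + K) (hℓj : ℓ ≤ j)
    {c : Site (F.P K) ℓ'} {B : Site (F.P K) ℓ} (hcB : (↑(iterBlock ℓ' c) : Set (Site (F.P K) 0)) ⊆ ↑(iterBlock ℓ B))
    (hc : (↑(iterBlock ℓ' c) : Set (Site (F.P K) 0)) ⊆ (s.Λ i)ᶜ) : (↑(iterBlock ℓ B) : Set (Site (F.P K) 0)) ⊆ (s.Λ j)ᶜ :=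
  iterBlock_subset_Λ_compl_of_subset F ν M g K k s hi hij hjk hℓ' hℓ (pow_dvd_dCubeSide_of_le _ _ _ hℓj) hcB hc

variable (lv : ℕ → ℕ)

open scoped Classical in
/-- ★★ **THE FRESH CAUSE**: if the level-`lv j` block `B` lies in `Z_j` (`1 ≤ j`; block levels `lv` monotone on `[1, j]`, in the standing range, with `L^{lv i}` dividing the
level-`i` cube side for `i ≤ j`), then at the LEAST level `i ∈ [1, j]` at which `B` meets the large-field region there is a level-`lv i` block `c ⊆ B` with `c ⊆ Z_i` and — when `i ≥ 2` —
`c ⊆ Λ_{i−1}`: a FRESH large-field block. [cite: Balaban1988Convergent, (2.1) p.254, (2.3) p.255; Balaban1989LargeFieldII, (1.79) p.383 (bookkeeping)] -/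
theorem exists_fresh_of_iterBlock_subset_Λ_compl {j : ℕ} (hmono : ∀ i i', 1 ≤ i → i ≤ i' → i' ≤ j → lv i ≤ lv i') (hlv : ∀ i, lv i ≤ F.m + K)
    (hdvd : ∀ i, 1 ≤ i → i ≤ j → F.L ^ lv i ∣ dCubeSide F.L M (RkOfRecord F.L ν.r (g i)) i) (h1 : 1 ≤ j) {B : Site (F.P K) (lv j)}
    (hB : (↑(iterBlock (lv j) B) : Set (Site (F.P K) 0)) ⊆ (s.Λ j)ᶜ) :
    ∃ i ∈ Finset.Icc 1 j, ∃ c : Site (F.P K) (lv i), (↑(iterBlock (lv i) c) : Set (Site (F.P K) 0)) ⊆ ↑(iterBlock (lv j) B) ∧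
      (↑(iterBlock (lv i) c) : Set (Site (F.P K) 0)) ⊆ (s.Λ i)ᶜ ∧ (2 ≤ i → (↑(iterBlock (lv i) c) : Set (Site (F.P K) 0)) ⊆ s.Λ (i - 1)) := by
  -- the levels at which the block meets the large-field region
  set T : Finset ℕ := (Finset.Icc 1 j).filter (fun i => ∃ x ∈ iterBlock (lv j) B, x ∈ (s.Λ i)ᶜ) with hT
  obtain ⟨x₀, hx₀⟩ := exists_mem_iterBlock (P := F.P K) (hlv j) B
  have hjT : j ∈ T := Finset.mem_filter.2 ⟨Finset.mem_Icc.2 ⟨h1, le_rfl⟩, x₀, hx₀, hB (Finset.mem_coe.2 hx₀)⟩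
  have hTne : T.Nonempty := ⟨j, hjT⟩
  set i := T.min' hTne with hi
  have hiT : i ∈ T := Finset.min'_mem T hTne
  obtain ⟨hiIcc, x, hxB, hxZ⟩ := Finset.mem_filter.1 hiT
  obtain ⟨hi1, hij⟩ := Finset.mem_Icc.1 hiIcc
  refine ⟨i, hiIcc, iterBlockOf (lv i) x, ?_, ?_, ?_⟩
  · -- nesting: the finer block of `x` lies in `B`
    exact iterBlock_subset_iterBlock_of_mem (hmono i j hi1 hij le_rfl) ((mem_iterBlock _ _ _).2 rfl) hxB
  · -- saturation of `Z_i` at block level `lv i`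
    exact iterBlock_subset_of_mem_image (blockSaturated_seq_Λ_compl F ν M g K k s (hlv i) (hdvd i hi1 hij)) ⟨x, hxZ, rfl⟩
  · -- freshness: no point of the block met the large-field region one level earlier (minimality of `i`)
    intro h2 y hy
    by_contra hyΛ
    have hyB : y ∈ iterBlock (lv j) B :=
      iterBlock_subset_iterBlock_of_mem (hmono i j hi1 hij le_rfl) ((mem_iterBlock _ _ _).2 rfl) hxB hy
    have hmem : i - 1 ∈ T := Finset.mem_filter.2 ⟨Finset.mem_Icc.2 ⟨by omega, by omega⟩, y, hyB, hyΛ⟩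
    have hle : i ≤ i - 1 := hi ▸ Finset.min'_le T (i - 1) hmem
    omega

open scoped Classical in
/-- ★★ **THE INSIDE EVENT IS THE UNION OF THE FRESH-BLOCK EVENTS BELOW IT**: under the hypotheses of `exists_fresh_of_iterBlock_subset_Λ_compl`, the level-`lv j` block `B`
lies in `Z_j` iff some level-`lv i` block `c ⊆ B`, `1 ≤ i ≤ j`, lies in `Z_i` and (for `i ≥ 2`) in `Λ_{i−1}` (the converse is inheritance; freshness is not needed for it).
[cite: Balaban1988Convergent, (2.1) p.254, (2.3) p.255; Balaban1989LargeFieldII, (1.79) p.383 (bookkeeping)] -/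
theorem iterBlock_subset_Λ_compl_iff_exists_fresh {j : ℕ} (hmono : ∀ i i', 1 ≤ i → i ≤ i' → i' ≤ j → lv i ≤ lv i') (hlv : ∀ i, lv i ≤ F.m + K)
    (hdvd : ∀ i, 1 ≤ i → i ≤ j → F.L ^ lv i ∣ dCubeSide F.L M (RkOfRecord F.L ν.r (g i)) i) (h1 : 1 ≤ j) (hjk : j ≤ k) (B : Site (F.P K) (lv j)) :
    (↑(iterBlock (lv j) B) : Set (Site (F.P K) 0)) ⊆ (s.Λ j)ᶜ ↔
      ∃ i ∈ Finset.Icc 1 j, ∃ c : Site (F.P K) (lv i), (↑(iterBlock (lv i) c) : Set (Site (F.P K) 0)) ⊆ ↑(iterBlock (lv j) B) ∧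
        (↑(iterBlock (lv i) c) : Set (Site (F.P K) 0)) ⊆ (s.Λ i)ᶜ ∧ (2 ≤ i → (↑(iterBlock (lv i) c) : Set (Site (F.P K) 0)) ⊆ s.Λ (i - 1)) := by
  constructor
  · exact exists_fresh_of_iterBlock_subset_Λ_compl F ν M g K k s lv hmono hlv hdvd h1
  · rintro ⟨i, hi, c, hcB, hc, -⟩
    obtain ⟨hi1, hij⟩ := Finset.mem_Icc.1 hi
    exact iterBlock_subset_Λ_compl_of_subset F ν M g K k s hi1 hij hjk (hlv i) (hlv j) (hdvd j h1 le_rfl) hcB hc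

/-- At block levels `lv i ≤ i` on `[1, j]` the divisibility hypothesis holds (`L^{lv i}` divides `L^i · M · R_i`). [cite: Balaban1988Convergent, (2.1) p.254 (bookkeeping)] -/
theorem hdvd_of_lv_le {j : ℕ} (hlvle : ∀ i, 1 ≤ i → i ≤ j → lv i ≤ i) : ∀ i, 1 ≤ i → i ≤ j → F.L ^ lv i ∣ dCubeSide F.L M (RkOfRecord F.L ν.r (g i)) i :=
  fun i hi hij => pow_dvd_dCubeSide_of_le _ _ _ (hlvle i hi hij)

end Fresh

/-! ## §3  Counting the finer blocks inside a block -/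

section Count

variable {P : Params} {ℓ ℓ' : ℕ}

open scoped Classical in
/-- A block is the disjoint union of the finer blocks inside it. [cite: Balaban1984PropagatorsI, (1.16) p.20 (bookkeeping)] -/
theorem biUnion_filter_iterBlock_subset_eq (h : ℓ' ≤ ℓ) (B : Site P ℓ) :
    (Finset.univ.filter fun c : Site P ℓ' => (↑(iterBlock ℓ' c) : Set (Site P 0)) ⊆ ↑(iterBlock ℓ B)).biUnion (iterBlock ℓ') = iterBlock ℓ B := by
  ext x
  simp only [Finset.mem_biUnion, Finset.mem_filter, Finset.mem_univ, true_and]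
  constructor
  · rintro ⟨c, hcB, hxc⟩
    exact hcB (Finset.mem_coe.2 hxc)
  · intro hxB
    exact ⟨iterBlockOf ℓ' x, iterBlock_subset_iterBlock_of_mem h ((mem_iterBlock _ _ _).2 rfl) hxB, (mem_iterBlock _ _ _).2 rfl⟩

open scoped Classical in
/-- **A LEVEL-`ℓ` BLOCK CONTAINS EXACTLY `(L^d)^{ℓ−ℓ′}` LEVEL-`ℓ′` BLOCKS** (`ℓ′ ≤ ℓ`, standing range). [cite: Balaban1984PropagatorsI, (1.16)–(1.18) p.20 (bookkeeping)] -/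
theorem card_filter_iterBlock_subset (h : ℓ' ≤ ℓ) (hℓ : ℓ ≤ P.m + P.K) (B : Site P ℓ) :
    (Finset.univ.filter fun c : Site P ℓ' => (↑(iterBlock ℓ' c) : Set (Site P 0)) ⊆ ↑(iterBlock ℓ B)).card = (P.L ^ P.d) ^ (ℓ - ℓ') := by
  set A := Finset.univ.filter fun c : Site P ℓ' => (↑(iterBlock ℓ' c) : Set (Site P 0)) ⊆ ↑(iterBlock ℓ B) with hA
  have hℓ' : ℓ' ≤ P.m + P.K := h.trans hℓ
  have hcount : (P.L ^ P.d) ^ ℓ = A.card * (P.L ^ P.d) ^ ℓ' := by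
    rw [← card_iterBlock ℓ hℓ B, ← biUnion_filter_iterBlock_subset_eq h B,
      Finset.card_biUnion (fun c _ c' _ hcc => pairwiseDisjoint_iterBlock ℓ' Set.univ (Set.mem_univ c) (Set.mem_univ c') hcc),
      Finset.sum_congr rfl fun c _ => card_iterBlock ℓ' hℓ' c, Finset.sum_const, smul_eq_mul]
  have hpos : 0 < (P.L ^ P.d) ^ ℓ' := pow_pos (pow_pos P.L_pos _) _
  have hsplit : (P.L ^ P.d) ^ ℓ = (P.L ^ P.d) ^ (ℓ - ℓ') * (P.L ^ P.d) ^ ℓ' := by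
    rw [← pow_add, Nat.sub_add_cancel h]
  rw [hsplit] at hcount
  exact (Nat.eq_of_mul_eq_mul_right hpos hcount).symm

end Count

/-! ## §4 (v1.1, APPEND-ONLY; every declaration above byte-identical, no import change) A fresh block is created by one of print's two mechanisms of its level -/

section Stage

variable (F : T4Family) (ν : Stage7Numerics) (M : ℕ) (g : ℕ → ℝ) (K k : ℕ) (s : B14.Eq218Concrete.Seq (DOfRecord F ν M g K) k)

/-- **THE DOMAINS `Ω_j` OF EVERY ADMISSIBLE SEQUENCE OF RECORD ARE `ℓ`-BLOCK-SATURATED** when `L^ℓ` divides the level-`j` cube side (inside the window by admissibility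
`Chain21.memΩ`, outside it `Ω_j = ∅`) — the `Ω`-twin of gen 33's `blockSaturated_seq_Λ`. [cite: Balaban1988Convergent, (2.1)–(2.2) p.254 (bookkeeping)] -/
theorem blockSaturated_seq_Ω {j ℓ : ℕ} (hℓ : ℓ ≤ F.m + K) (hdvd : F.L ^ ℓ ∣ dCubeSide F.L M (RkOfRecord F.L ν.r (g j)) j) :
    ∀ ⦃x x' : Site (F.P K) 0⦄, iterBlockOf ℓ x = iterBlockOf ℓ x' → x ∈ s.Ω j → x' ∈ s.Ω j := by
  by_cases hj : 1 ≤ j ∧ j ≤ k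
  · exact blockSaturated_of_mem_dOfRecord_of_dvd F ν M g K hℓ hdvd (s.chain.memΩ j hj.1 hj.2)
  · intro x x' _ hx
    rw [s.Ω_off j hj] at hx
    exact hx.elim

/-- A block that MEETS a saturated `Ω_j` lies INSIDE it; so every block either lies inside `Ω_j` or is disjoint from it. [cite: Balaban1988Convergent, (2.1) p.254 (bookkeeping)] -/
theorem iterBlock_subset_Ω_or_subset_compl {j ℓ : ℕ} (hℓ : ℓ ≤ F.m + K) (hdvd : F.L ^ ℓ ∣ dCubeSide F.L M (RkOfRecord F.L ν.r (g j)) j) (c : Site (F.P K) ℓ) :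
    (↑(iterBlock ℓ c) : Set (Site (F.P K) 0)) ⊆ s.Ω j ∨ (↑(iterBlock ℓ c) : Set (Site (F.P K) 0)) ⊆ (s.Ω j)ᶜ := by
  by_cases h : ∃ x ∈ iterBlock ℓ c, x ∈ s.Ω j
  · obtain ⟨x, hxc, hxΩ⟩ := h
    exact Or.inl (iterBlock_subset_of_mem_image (blockSaturated_seq_Ω F ν M g K k s hℓ hdvd) ⟨x, hxΩ, (mem_iterBlock ℓ c x).1 hxc⟩)
  · exact Or.inr fun x hx hxΩ => h ⟨x, Finset.mem_coe.1 hx, hxΩ⟩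

/-- ★ **A FRESH BLOCK IS CREATED BY ONE OF THE TWO MECHANISMS OF ITS LEVEL** ([III] (2.1) p. 254: `Λ_{i−1} ⊇ Ω_i ⊇ Λ_i`): for `1 ≤ i ≤ k` and a block `c` of a level `ℓ` with `L^ℓ`
dividing the level-`i` cube side, «`c ⊆ Z_i` and (`i ≥ 2 →`) `c ⊆ Λ_{i−1}`» holds iff EITHER `c` is excluded at the FIRST restriction of step `i` (`c ⊆ (Ω_i)ᶜ`, with `c ⊆ Λ_{i−1}`
when `i ≥ 2`) OR `c` passes the first and is excluded at the SECOND (`c ⊆ Ω_i ∖ Λ_i`; then `c ⊆ Ω_i ⊆ Λ_{i−1}` automatically) — by the `Ω_i`-saturation dichotomy.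
[cite: Balaban1988Convergent, (2.1) p.254, (2.3) p.255, (2.17)–(2.18) p.257 (bookkeeping)] -/
theorem fresh_iff_stage_one_or_two {i ℓ : ℕ} (hi : 1 ≤ i) (hik : i ≤ k) (hℓ : ℓ ≤ F.m + K) (hdvd : F.L ^ ℓ ∣ dCubeSide F.L M (RkOfRecord F.L ν.r (g i)) i)
    (c : Site (F.P K) ℓ) :
    ((↑(iterBlock ℓ c) : Set (Site (F.P K) 0)) ⊆ (s.Λ i)ᶜ ∧ (2 ≤ i → (↑(iterBlock ℓ c) : Set (Site (F.P K) 0)) ⊆ s.Λ (i - 1))) ↔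
      ((↑(iterBlock ℓ c) : Set (Site (F.P K) 0)) ⊆ (s.Ω i)ᶜ ∧ (2 ≤ i → (↑(iterBlock ℓ c) : Set (Site (F.P K) 0)) ⊆ s.Λ (i - 1))) ∨
      ((↑(iterBlock ℓ c) : Set (Site (F.P K) 0)) ⊆ s.Ω i ∧ (↑(iterBlock ℓ c) : Set (Site (F.P K) 0)) ⊆ (s.Λ i)ᶜ) := by
  have hΛΩ : s.Λ i ⊆ s.Ω i := s.chain.Λ_subset i hi hik
  constructor
  · rintro ⟨hZ, hprev⟩
    rcases iterBlock_subset_Ω_or_subset_compl F ν M g K k s hℓ hdvd c with hΩ | hΩc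
    · exact Or.inr ⟨hΩ, hZ⟩
    · exact Or.inl ⟨hΩc, hprev⟩
  · rintro (⟨hΩc, hprev⟩ | ⟨hΩ, hZ⟩)
    · exact ⟨fun x hx hxΛ => hΩc hx (hΛΩ hxΛ), hprev⟩
    · refine ⟨hZ, fun h2 => ?_⟩
      have hΩΛ : s.Ω i ⊆ s.Λ (i - 1) := by
        have h := s.chain.Ω_succ_subset (i - 1) (by omega) (by omega)
        rwa [Nat.sub_add_cancel hi] at h
      exact hΩ.trans hΩΛ

end Stage

end Literature.MathematicalPhysics.QuantumFieldTheory.Balaban1983to89.Node00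

end
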